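import Literature.Analysis.FluidPDE.AncientSimilarityVariables
import Literature.Analysis.FluidPDE.CurlFreeLiouville
import HarnessLib

/-!
# Crux `HubbleDynamo.NoSelfExcitedDynamo` (stmt-NavierStokesRegularity-1934), line `registered`:
# stub `stub_curlFreeLiouville` — a curl-free eternal backward Leray solution in the profile class is `0`

Helper file (`--supports stmt-NavierStokesRegularity-1934`; theorems only, sorry-free). Let `(U, P)`
be a classical solution of Leray's backward system `∂ₛU + ½U + ½(y·∇)U + (U·∇)U + ∇P = ΔU`,
`div U = 0` on the whole similarity space–time `ℝ × ℝ³` (`IsBackwardLeraySolutionOn univ 1 U P`) in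
the uniform profile class `(1 + ‖y‖)^{k+1} ‖Dᵏ U(s, ·)(y)‖ ≤ K_k`, whose vorticity `curl U(s, ·)`
vanishes identically. Then `U ≡ 0`.

Proof. Fix `s`. The slice `U s` is `C^∞` (`IsSmoothSpaceTimeOn.contDiff_slice`), divergence free,
curl free, and bounded by `K₀` (the `k = 0` profile bound and `‖D⁰U‖ = ‖U‖`), hence constant by the
tree's Liouville theorem for the system `curl V = 0`, `div V = 0`
(`Literature.Analysis.FluidPDE.eq_of_curl_eq_zero_of_isDivFree_of_bounded`, KNSS 2009 Lemma 3.1).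
The constant value `c = U s y` satisfies `(1 + ‖z‖) ‖c‖ ≤ K₀` for every `z`; testing at
`z = R e₀` with `R = |K₀| / ‖c‖ + 1` gives `|K₀| + 2‖c‖ ≤ K₀`, absurd unless `c = 0`.

## References

* G. Koch, N. Nadirashvili, G. Seregin, V. Šverák, *Liouville theorems for the Navier–Stokes
  equations and applications*, Acta Math. 203 (2009) 83–105, Lemma 3.1. [KochNadirashviliSereginSverak2009]
-/

noncomputable section

-- the registered stub namespace repeats the summit name `NavierStokesRegularity` (summit = problem)
set_option linter.dupNamespace false

namespace Summit.NavierStokesRegularity.NavierStokesRegularity.Theorems.NoSelfExcitedDynamo.Registered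

open Set MeasureTheory Filter Topology
open Literature.Analysis.FluidPDE

/-- The weight kills constants: if `(1 + ‖z‖) * ‖c‖ ≤ K` for every `z : ℝ³`, then `c = 0`
(test at `z = R e₀` with `R = |K| / ‖c‖ + 1`). -/
private theorem curlFree_eq_zero_of_weighted_bound {c : EuclideanSpace ℝ (Fin 3)} {K : ℝ}
    (h : ∀ z : EuclideanSpace ℝ (Fin 3), (1 + ‖z‖) * ‖c‖ ≤ K) : c = 0 := by
  by_contra hne
  have hpos : 0 < ‖c‖ := norm_pos_iff.mpr hne
  set R : ℝ := |K| / ‖c‖ + 1 with hR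
  have hRpos : 0 < R := by positivity
  have hz : ‖EuclideanSpace.single (0 : Fin 3) R‖ = R := by
    simp [Real.norm_eq_abs, abs_of_pos hRpos]
  have hmul : R * ‖c‖ = |K| + ‖c‖ := by
    rw [hR, add_mul, one_mul, div_mul_cancel₀ _ hpos.ne']
  have hle := h (EuclideanSpace.single (0 : Fin 3) R)
  rw [hz, add_mul, one_mul, hmul] at hle
  have hK : K ≤ |K| := le_abs_self K
  linarith

/-- **Stub `stub_curlFreeLiouville`** (KNSS 2009, Lemma 3.1: the Liouville step for the system
`curl U = 0`, `div U = 0`). An eternal classical solution `(U, P)` of the backward Leray system on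
`ℝ × ℝ³` in the uniform profile class `(1 + ‖y‖)^{k+1} ‖Dᵏ U(s, ·)(y)‖ ≤ K_k` whose vorticity vanishes
identically is zero: each slice `U s` is smooth, divergence free, curl free and bounded, hence
constant (`eq_of_curl_eq_zero_of_isDivFree_of_bounded`), and the weight `(1 + ‖y‖) ‖U‖ ≤ K₀` forces
the constant to vanish. -/
theorem stub_curlFreeLiouville :
    ∀ (U : ℝ → EuclideanSpace ℝ (Fin 3) → EuclideanSpace ℝ (Fin 3)) (P : ℝ → EuclideanSpace ℝ (Fin 3) → ℝ),
      IsBackwardLeraySolutionOn univ 1 U P →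
      (∀ k : ℕ, ∃ K : ℝ, ∀ s y, (1 + ‖y‖) ^ (k + 1) * ‖iteratedFDeriv ℝ k (U s) y‖ ≤ K) →
      (∀ s y, curl (U s) y = 0) → ∀ s y, U s y = 0 := by
  intro U P h hK hcurl s y
  obtain ⟨K, hK0⟩ := hK 0
  -- the order-zero profile bound: `(1 + ‖z‖) ‖U s z‖ ≤ K`
  have hw : ∀ z, (1 + ‖z‖) * ‖U s z‖ ≤ K := fun z => by
    simpa [norm_iteratedFDeriv_zero] using hK0 s z
  -- hence the slice is bounded by `K`
  have hb : ∀ z, ‖U s z‖ ≤ K := fun z => by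
    have h1 := hw z
    nlinarith [norm_nonneg (U s z), norm_nonneg z]
  -- the slice is `C²`, curl free and divergence free, hence constant
  have h2 : ContDiff ℝ 2 (U s) :=
    (h.smooth_velocity.contDiff_slice (mem_univ s)).of_le (by norm_cast)
  have hconst : ∀ z, U s z = U s y := fun z =>
    eq_of_curl_eq_zero_of_isDivFree_of_bounded h2 (hcurl s) (h.divFree s (mem_univ s)) hb z y
  -- and the weighted bound kills the constant
  exact curlFree_eq_zero_of_weighted_bound (K := K) fun z => by rw [← hconst z]; exact hw z

end Summit.NavierStokesRegularity.NavierStokesRegularity.Theorems.NoSelfExcitedDynamo.Registered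

end
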